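import Literature.MathematicalPhysics.QuantumFieldTheory.Balaban1983to89.B16Cor3ActionBounds
import Literature.MathematicalPhysics.QuantumFieldTheory.Balaban1983to89.B16CurlyBracketVolume

/-!
# `Balaban1983to89.B16Cor3CurlyGas` — Corollary 3 ∕ (2.50) [III] ∕ (0.1) of [Balaban1989LargeFieldII], one run, one step,
# ON THE TORUS, with the CURLY-BRACKET binders `hcurly`∕`h0c`∕`hR` of the Cor 3 chain DISCHARGED from per-term (1.90)-gas
# data (and the effective-action binders from (2.49) [III], by `B16Cor3ActionBounds`): the one call in which every step of
# pp. 383–391 that print DERIVES is kernel, and whose remaining binders are the datum, the factor leaves and the gas leaves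

CITATION HEADER (lean-in-tree rule 2026-08-18).  Sources: T. Bałaban, *Large field renormalization. II. Localization,
exponentiation, and bounds for the 𝐑 operation*, Commun. Math. Phys. **122**, 355–392 (1989), doi:10.1007/bf01238433
[Balaban1989LargeFieldII] (cell paper B16 = [V]; held: `paper:balaban1989-cmp122-large-field-ii`; journal page = PDF page +
354) and T. Bałaban, *Convergent renormalization expansions for lattice gauge theories*, Commun. Math. Phys. **119**, 243–285
(1988) [Balaban1988Convergent] ([III]).  WHAT IS PRINTED: [V] p. 387 [33]: *"Next, we have noticed already that the inequality
(1.79) holds for the 𝐓-operation connected with an arbitrary large field region. The inequality (1.80) holds quite generally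
for such regions, hence also an improved bound (1.89), with the additional term −κ₁d_k(X) in the exponential. This implies the
inequality (2.50) [III], hence Corollary 3."*; [V] p. 390 [36]: *"{⋯} = exp 𝐑′^{(k)} = exp Σ_X 𝐑′^{(k)}(X). (1.98) … From
(1.72), (1.98), and the above definitions, it follows that the result 𝐑ρ_k of the 𝐑-operation can be written in the form
(2.18) [III]"*; [III] p. 264 [22]: *"A_k(1/g_k², U_k) = −A(1/g_k², U_k) + (the logarithmic terms) + O(1) Σ_{j=1}^{k} |Γ_j|.
(2.49) … χ_k exp[−(1/g_k²)A(U_k(V_k)) − E₋|T_η|] ≦ ρ_k(V_k) ≦ exp E₊|T_η|. (2.50)"*.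

WHY THIS FILE (HUMAN RULING D-0062, Track A full width; DAG node N13 = [B16] Thm 1 + Cor 3; seat dag-n14-b on the Cor 3
half «(5) the curly bracket», dag-lead REBALANCE №3 ∕ №6B).  The Cor 3 chain of the surge-node lineage (`B14Cor3` → `B16Cor3`
→ `B16Cor3Scales` → `B16Cor3Ops` → `B16Cor3Wilson` → `B16Cor3Torus`) proves (2.50) for one run and one step from (1.72) over
the torus catalogue with the geometry DISCHARGED; `B16Cor3ActionBounds` (dag-n21-b, p409433) replaced its effective-action
binders `hA′`∕`hA′up` by (2.49); `B16CurlyBracketVolume` (this seat, p409558) PROVED the volume bound of the exponentiated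
curly bracket of (1.72) from the landed (1.90) gas.  Here the two are COMPOSED: `uvIneq_of_repr172_torus_of_ineq249_of_gas`
= `B16Cor3ActionBounds.uvIneq_of_repr172_torus_of_ineq249` with `hcurly`, `h0c`, `hR` REPLACED by per-term (1.90)-gas data —
for every admissible term `a` of the representation (1.72): its fixed cubes `Yfix a` (⋃_i Y_i), its family operation `Op a`
(`LocalOps`: the product of the 𝐓′_k(X_j), locality p. 378 ∕ (2.19) [III]; reality-preserving at a real configuration,
p. 379–380), its localization terms `V a` (`DepOn`, real), on ONE finite cube type with a reflexive symmetric footprint-local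
adjacency, the (1.97)-shaped activity bound of the Mayer terms (`h197`, proved from the (1.68)∕(1.73)·(1.89) leaves and the
geometric leaves by `B16Eq190Resummation.norm_F191_mayerTerm_le`), the relative leaves (1.26)_rel ∕ volume bound and the
Kotecký–Preiss constants UNIFORM in the term, the cube count `#cubes ≤ πc·|T₁^{(k)}|` (torus: `πc = M⁻⁴`), and the JUNCTION
`R.curly a V = ({⋯}_a V).re` — whence `E₋ = C·c_Γ + c_L + πc·b`, `E₊ = C·c_Γ + c_L′ + πc·b + M⁻⁴·K₀(64,8)·Σ_i e^{−c_i}`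
with `b = c₁ e^{τ c_v} K₀` (both `g_k`-dependent through `c_L`, `c_L′`, as in `B16Cor3ActionBounds`).

WHAT REMAINS A BINDER after this call (nothing derivable on pp. 383–391): the datum `hH : R.Holds (D.ρ k)` ((1.72) holds for
the density — NODE 00) with the χ-dictionary `hχ01`∕`h0χ`; the factor leaves `hZ`∕`hY` ((1.79)∕(1.89)-improved per component —
they bottom out at WHAT 𝐓′_k(X) IS, object level; or the Wilson mechanism of `B16Cor3Wilson`); the (2.49) inputs of [III]
(`h249`, volume majorant, log-term bounds); and the gas leaves themselves (`LocalOps`∕`DepOn`∕`h197`∕relative leaves at the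
genuine operations — object level).  HONEST FRAMING: composition BY NAME of landed modules; nothing of Bałaban's asserted;
NOT a discharge of N13; count-neutral; finite T⁴ at fixed ε; nothing continuum ∕ ℝ⁴ ∕ OS ∕ mass-gap ∕ Clay.  0 sorry,
axioms standard; no existing module is modified.
-/

noncomputable section

namespace Literature.MathematicalPhysics.QuantumFieldTheory.Balaban1983to89.B16Cor3CurlyGas

open Finset
open B14Thm2 (Ineq249)
open B16Cor3Ops (Repr172)
open TreeLengthTorus (tsys)
open B13FamilySum (Ineq126 VolBound)
open B16Eq190Resummation (bracket mayerTerm F191 polys190 LocalOps DepOn)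
open B16CurlyBracketVolume (norm_bracket_le_exp_of_localOps exists_log_bracket_of_localOps card_outsideCubes_le
  hcurly_shape h0c_shape)

variable (D : B16.RunData) (k : ℕ)

/-- **THE CURLY-BRACKET BINDERS OF THE COR 3 CHAIN FROM (1.90)-GAS DATA.**  For every admissible term `a` of (1.72) whose
curly bracket at the configuration `V` is (the real part of) the exponentiated gas `{⋯}_a = bracket (Op a) (Vt a) (cfg V)` with
the locality ∕ reality ∕ activity ∕ relative-leaf ∕ Kotecký–Preiss hypotheses of `B16CurlyBracketVolume.exists_log_bracket_of_localOps`
UNIFORM in `a`, and a cube count `#cubes ≤ πc·N`: the three binders `hcurly` (`0 ≤ curly ≤ e^{ε′N}`), `h0c` (`curly_{allSmall} =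
e^{Rre}`) and `hR` (`|Rre| ≤ εN`) of `B16Cor3Ops.Repr172.uvIneq_of_repr172` hold with `ε = ε′ = πc·c₁e^{τc_v}K₀` and
`Rre V = Re Σ_X 𝐑′^{(k)}(X)` of the all-small term. [cite: Balaban1989LargeFieldII, (1.98) p.390] -/
theorem curlyBinders_of_gas {Dom : Type*} (R : Repr172 (D.Cfg k) Dom)
    {LF DomY Cube Var Sv : Type*} [Fintype LF] [Fintype DomY] [Fintype Cube] [DecidableEq LF] [DecidableEq DomY]
    [DecidableEq Cube] {adjC : Cube → Cube → Prop} [DecidableRel adjC]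
    (hrefl : ∀ a, adjC a a) (hsymm : ∀ a b, adjC a b → adjC b a)
    {locX : LF → Finset Cube} {locY : DomY → Finset Cube} {site : Var → Cube} (Yfix : R.Adm → Finset Cube)
    (houtX : ∀ a j, (locX j \ Yfix a).Nonempty) (houtY : ∀ a Y, (locY Y \ Yfix a).Nonempty)
    (Op : R.Adm → Finset LF → ((Var → Sv) → ℂ) →+ ((Var → Sv) → ℂ))
    (hOps : ∀ a, LocalOps adjC locX (Yfix a) site (Op a))
    (hOpReal : ∀ a (S : Finset LF) (f : (Var → Sv) → ℂ), (∀ ψ, (f ψ).im = 0) → ∀ φ, (Op a S f φ).im = 0)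
    (Vt : R.Adm → DomY → (Var → Sv) → ℂ) (hV : ∀ a Y, DepOn (Yfix a) site (Vt a Y) (locY Y))
    (hVreal : ∀ a Y ψ, (Vt a Y ψ).im = 0) (cfg : D.Cfg k → (Var → Sv))
    {nbr : Cube → Finset Cube} (hnbr : ∀ a b, adjC a b → a ∈ nbr b) {ν : ℝ} (hν : ∀ b, ((nbr b).card : ℝ) ≤ ν)
    {d : R.Adm → Finset Cube → ℝ} {c₁ Rr κ₀ K₀ cv τ : ℝ} (hd : ∀ a X, 0 ≤ d a X) (hc₁ : 0 ≤ c₁) (hK₀ : 0 ≤ K₀)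
    (hτ : 0 ≤ τ)
    (h197 : ∀ a V X, ‖F191 adjC locX locY (Yfix a) (mayerTerm (Op a) (Vt a) (cfg V)) X‖ ≤ c₁ * Real.exp (-(Rr * d a X)))
    (h126 : ∀ a, Ineq126 (polys190 adjC locX locY (Yfix a)) (fun X => X \ Yfix a) (d a) κ₀ K₀)
    (hvol : ∀ a, VolBound (polys190 adjC locX locY (Yfix a)) (fun X => X \ Yfix a) (d a) cv)
    (hrate : κ₀ + τ * cv ≤ Rr) (hsmall : c₁ * Real.exp (τ * cv) * K₀ * ν ≤ τ)
    (hjunction : ∀ a V, R.curly a V = (bracket (Op a) (Vt a) (cfg V)).re)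
    {πc : ℝ} (hQ : (Fintype.card Cube : ℝ) ≤ πc * (D.numSites k : ℝ)) :
    ∃ Rre : D.Cfg k → ℝ,
      (∀ a V, 0 ≤ R.curly a V ∧
        R.curly a V ≤ Real.exp ((πc * (c₁ * Real.exp (τ * cv) * K₀)) * (D.numSites k : ℝ))) ∧
      (∀ V, R.curly R.allSmall V = Real.exp (Rre V)) ∧
      (∀ V, |Rre V| ≤ (πc * (c₁ * Real.exp (τ * cv) * K₀)) * (D.numSites k : ℝ)) := by
  set b : ℝ := c₁ * Real.exp (τ * cv) * K₀ with hb
  have hb0 : 0 ≤ b := mul_nonneg (mul_nonneg hc₁ (Real.exp_nonneg _)) hK₀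
  -- the gas facts, term by term
  have hgas : ∀ a V, (bracket (Op a) (Vt a) (cfg V)).im = 0 ∧ 0 < (bracket (Op a) (Vt a) (cfg V)).re ∧
      ∃ ρ : ℝ, |ρ| ≤ (((polys190 adjC locX locY (Yfix a)).biUnion fun X => X \ Yfix a).card : ℝ) * b ∧
        bracket (Op a) (Vt a) (cfg V) = ((Real.exp ρ : ℝ) : ℂ) := fun a V =>
    exists_log_bracket_of_localOps hrefl hsymm (houtX a) (houtY a) (hOps a) (hOpReal a) (hV a) (hVreal a) (cfg V)
      hnbr hν (hd a) hc₁ hK₀ hτ (h197 a V) (h126 a) (hvol a) hrate hsmall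
  have hnorm : ∀ a V, ‖bracket (Op a) (Vt a) (cfg V)‖
      ≤ Real.exp ((((polys190 adjC locX locY (Yfix a)).biUnion fun X => X \ Yfix a).card : ℝ) * b) := fun a V =>
    norm_bracket_le_exp_of_localOps hrefl hsymm (houtX a) (houtY a) (hOps a) (hV a) (cfg V) hnbr hν (hd a) hc₁ hK₀ hτ
      (h197 a V) (h126 a) (hvol a) hrate hsmall
  -- the outside-cube count against the site count
  have hcard : ∀ a, ((((polys190 adjC locX locY (Yfix a)).biUnion fun X => X \ Yfix a).card : ℕ) : ℝ)
      ≤ πc * (D.numSites k : ℝ) := fun a => by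
    have h := card_outsideCubes_le (adjC := adjC) (locX := locX) (locY := locY) (Yfix := Yfix a)
    have h' : ((((polys190 adjC locX locY (Yfix a)).biUnion fun X => X \ Yfix a).card : ℕ) : ℝ)
        ≤ (Fintype.card Cube : ℝ) := by exact_mod_cast h.1.trans h.2
    exact h'.trans hQ
  -- the real logarithm of the all-small term's curly bracket
  refine ⟨fun V => Classical.choose (hgas R.allSmall V).2.2, fun a V => ?_, fun V => ?_, fun V => ?_⟩
  · rw [hjunction a V]
    exact hcurly_shape (hgas a V).2.1 (hnorm a V) hb0 (hcard a)
  · have hρ := Classical.choose_spec (hgas R.allSmall V).2.2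
    rw [hjunction R.allSmall V]
    exact (h0c_shape hρ.2 hρ.1 hb0 (hcard R.allSmall)).1
  · have hρ := Classical.choose_spec (hgas R.allSmall V).2.2
    exact (h0c_shape hρ.2 hρ.1 hb0 (hcard R.allSmall)).2

/-- **THE TORUS ONE CALL OF THE COR 3 CHAIN WITH THE EFFECTIVE-ACTION BINDERS FROM (2.49) AND THE CURLY-BRACKET BINDERS
FROM THE (1.90) GAS** — `B16Cor3ActionBounds.uvIneq_of_repr172_torus_of_ineq249` with `hcurly`, `h0c`, `hR` supplied by
`curlyBinders_of_gas`: inputs the datum ((1.72) holds, χ dictionary), the factor leaves `hZ`∕`hY`, per-term (1.90)-gas data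
(locality + reality of the operations and localization terms, the (1.97)-shaped activity bound, the relative leaves, the
Kotecký–Preiss constants, the junction `curly = Re{⋯}`), the cube count `#cubes ≤ πc·N`, and (2.49) for `A′` with the volume
majorant and the log-term bounds; conclusion `B16.UVIneq` at every configuration with `E₋ = C·c_Γ + c_L + πc·b`,
`E₊ = C·c_Γ + c_L′ + πc·b + M⁻⁴·K₀(64,8)·Σ_i e^{−c_i}`, `b = c₁e^{τc_v}K₀`.  CONDITIONAL on every input; nothing of Bałaban's
asserted. [cite: Balaban1989LargeFieldII, (0.1) p.356 and p.387 after (1.89)] -/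
theorem uvIneq_of_repr172_torus_of_ineq249_of_gas (N : ℕ) [NeZero N] (R : Repr172 (D.Cfg k) (tsys 4 N).Dom)
    {M : ℝ} (hM : M ≠ 0) (hnum : (D.numSites k : ℝ) = (M * N) ^ 4)
    {κ₁ : ℝ} (hκ : B12TreeDecay.kappa₀ (4 * 2 ^ 4) (2 * 4) ≤ κ₁) (c : Fin 2 → ℝ)
    (hH : R.Holds (D.ρ k))
    (hχ01 : ∀ a V, 0 ≤ R.χ a V ∧ R.χ a V ≤ 1)
    (h0χ : ∀ V, R.χ R.allSmall V = D.χ k V)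
    (hZ : ∀ a V, (R.TZ a).T 1 V ≤ ∏ X ∈ R.Zc a, Real.exp (-(c 0) - κ₁ * (tsys 4 N).dj X))
    (hY : ∀ a V, (R.TYs a).T 1 V ≤ ∏ Y ∈ R.Ys a, Real.exp (-(c 1) - κ₁ * (tsys 4 N).dj Y))
    -- the (1.90) gas of every admissible term, replacing `hcurly`, `h0c`, `hR`
    {LF DomY Cube Var Sv : Type*} [Fintype LF] [Fintype DomY] [Fintype Cube] [DecidableEq LF] [DecidableEq DomY]
    [DecidableEq Cube] {adjC : Cube → Cube → Prop} [DecidableRel adjC]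
    (hrefl : ∀ a, adjC a a) (hsymm : ∀ a b, adjC a b → adjC b a)
    {locX : LF → Finset Cube} {locY : DomY → Finset Cube} {site : Var → Cube} (Yfix : R.Adm → Finset Cube)
    (houtX : ∀ a j, (locX j \ Yfix a).Nonempty) (houtY : ∀ a Y, (locY Y \ Yfix a).Nonempty)
    (Op : R.Adm → Finset LF → ((Var → Sv) → ℂ) →+ ((Var → Sv) → ℂ))
    (hOps : ∀ a, LocalOps adjC locX (Yfix a) site (Op a))
    (hOpReal : ∀ a (S : Finset LF) (f : (Var → Sv) → ℂ), (∀ ψ, (f ψ).im = 0) → ∀ φ, (Op a S f φ).im = 0)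
    (Vt : R.Adm → DomY → (Var → Sv) → ℂ) (hV : ∀ a Y, DepOn (Yfix a) site (Vt a Y) (locY Y))
    (hVreal : ∀ a Y ψ, (Vt a Y ψ).im = 0) (cfg : D.Cfg k → (Var → Sv))
    {nbr : Cube → Finset Cube} (hnbr : ∀ a b, adjC a b → a ∈ nbr b) {ν : ℝ} (hν : ∀ b, ((nbr b).card : ℝ) ≤ ν)
    {d : R.Adm → Finset Cube → ℝ} {c₁ Rr κ₀ K₀ cv τ : ℝ} (hd : ∀ a X, 0 ≤ d a X) (hc₁ : 0 ≤ c₁) (hK₀ : 0 ≤ K₀)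
    (hτ : 0 ≤ τ)
    (h197 : ∀ a V X, ‖F191 adjC locX locY (Yfix a) (mayerTerm (Op a) (Vt a) (cfg V)) X‖ ≤ c₁ * Real.exp (-(Rr * d a X)))
    (h126 : ∀ a, Ineq126 (polys190 adjC locX locY (Yfix a)) (fun X => X \ Yfix a) (d a) κ₀ K₀)
    (hvol : ∀ a, VolBound (polys190 adjC locX locY (Yfix a)) (fun X => X \ Yfix a) (d a) cv)
    (hrate : κ₀ + τ * cv ≤ Rr) (hsmall : c₁ * Real.exp (τ * cv) * K₀ * ν ≤ τ)
    (hjunction : ∀ a V, R.curly a V = (bracket (Op a) (Vt a) (cfg V)).re)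
    {πc : ℝ} (hQ : (Fintype.card Cube : ℝ) ≤ πc * (D.numSites k : ℝ))
    -- (2.49) for the effective action `A′` and its logarithmic terms (as in `B16Cor3ActionBounds`)
    (logT : D.Cfg k → ℝ) {C cΓ cL cL' : ℝ} {Γ : ℕ → ℝ} (hC : 0 ≤ C)
    (hΓ : ∑ n ∈ Finset.Icc 1 k, Γ n ≤ cΓ * (D.numSites k : ℝ))
    (h249 : ∀ V, Ineq249 (R.A' V) (1 / (D.flow.g k) ^ 2 * D.wilsonBG k V) (logT V) C Γ k)
    (hlog : ∀ V, -(cL * (D.numSites k : ℝ)) ≤ logT V) (hlog' : ∀ V, logT V ≤ cL' * (D.numSites k : ℝ))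
    (hA0 : ∀ V, 0 ≤ D.wilsonBG k V) :
    ∀ V : D.Cfg k, B16.UVIneq D k V (C * cΓ + cL + πc * (c₁ * Real.exp (τ * cv) * K₀))
      (C * cΓ + cL' + πc * (c₁ * Real.exp (τ * cv) * K₀) +
        M⁻¹ ^ 4 * B12TreeDecay.K₀ (4 * 2 ^ 4) (2 * 4) * ∑ i, Real.exp (-(c i))) := by
  obtain ⟨Rre, hcurly, h0c, hR⟩ := curlyBinders_of_gas D k R hrefl hsymm Yfix houtX houtY Op hOps hOpReal Vt hV hVreal cfg
    hnbr hν hd hc₁ hK₀ hτ h197 h126 hvol hrate hsmall hjunction hQ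
  exact B16Cor3ActionBounds.uvIneq_of_repr172_torus_of_ineq249 D k N R hM hnum hκ c Rre
    (πc * (c₁ * Real.exp (τ * cv) * K₀)) (πc * (c₁ * Real.exp (τ * cv) * K₀)) hH hχ01 h0χ hZ hY hcurly h0c hR logT hC hΓ
    h249 hlog hlog' hA0

end Literature.MathematicalPhysics.QuantumFieldTheory.Balaban1983to89.B16Cor3CurlyGas

end
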